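import Mathlib
import Literature.Computability.Complexity.RangeAvoidance
import Literature.Computability.Complexity.SignDegreeXor
import Summits.PneNP.PneNP.Theorems.PstarIsolation
import Summits.PneNP.PneNP.Theorems.PstarIsolationBound

/-!
# Isolation of the all-ones range point of a pure `P⋆` local map — the spectral (quadratic-form) promise

FRONTIER range-avoidance ladder, rung F-N3(ψ) (cell `pnp-ideate`, ROUND-19, mechanism M19; restricted-model
algorithmics — nothing here bears on `P` vs `NP`).

The promise `PstarIsolationBound.PseudoRandom η κ` asks for three DISCREPANCY inequalities at every vertex set `U`
(`2ⁿ` conditions).  The standard poly-time certificate for them is spectral: the expander mixing lemma in quadratic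
form.  This file states the promise at the level of QUADRATIC FORMS — for every real vector `x`,
`(m/n²)(Σ x)² − κ√C·‖x‖² ≤ q_L(x)`, `q_A(x) ≤ (m/n²)(Σ x)² + κ√C·‖x‖²`, `q_LA(x) ≤ 4(m/n²)(Σ x)² + 2κ√C·‖x‖²`,
where `q_L(x) = Σ_j x_{a_j} x_{b_j}` (`= ½ xᵀA_L x` for the XOR multigraph), `q_A`, and the co-occurrence form
`q_LA(x) = Σ_j (x_{a_j} + x_{b_j})(x_{c_j} + x_{d_j})` (`= ½ xᵀA_{LA} x`) — i.e. positive semi-definiteness of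
`½A_L − (m/n²)J + κ√C·I`, of `(m/n²)J + κ√C·I − ½A_A` and of `4(m/n²)J + 2κ√C·I − ½A_{LA}`, three `n × n` PSD tests —
and proves that it implies `PseudoRandom η κ` (`pseudoRandom_of_spectral`: evaluate at the indicator vector of `U`),
hence isolation and the FP rung (`allOnesIsolated_of_spectral`).
-/

set_option linter.dupNamespace false

open Finset Literature.Computability.Complexity
open Summit.PneNP.PneNP.Theorems.PstarIsolation
open Summit.PneNP.PneNP.Theorems.PstarIsolationBound (AllOnesIsolated PseudoRandom allOnesIsolated_of_pseudoRandom)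

namespace Summit.PneNP.PneNP.Theorems.PstarIsolationSpectral

variable {n m : ℕ}

/-! ## The quadratic forms of the three derived multigraphs -/

/-- Edge form of the XOR multigraph `G_L`: `q_L(x) = Σ_j x_{a_j}·x_{b_j}` (`= ½ xᵀ A_L x`). -/
def qL (I : LocalMap 4 n m) (x : Fin n → ℝ) : ℝ := ∑ j, x (I.vars j 0) * x (I.vars j 1)

/-- Edge form of the AND multigraph `G_A`: `q_A(x) = Σ_j x_{c_j}·x_{d_j}`. -/
def qA (I : LocalMap 4 n m) (x : Fin n → ℝ) : ℝ := ∑ j, x (I.vars j 2) * x (I.vars j 3)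

/-- Edge form of the XOR–AND co-occurrence multigraph `G_LA` (four edges per output):
`q_LA(x) = Σ_j (x_{a_j} + x_{b_j})·(x_{c_j} + x_{d_j})`. -/
def qLA (I : LocalMap 4 n m) (x : Fin n → ℝ) : ℝ :=
  ∑ j, (x (I.vars j 0) + x (I.vars j 1)) * (x (I.vars j 2) + x (I.vars j 3))

/-- The real indicator vector of a vertex set. -/
def ind (U : Finset (Fin n)) (v : Fin n) : ℝ := if v ∈ U then 1 else 0

/-- The indicator is the cast of `inU`. -/
theorem ind_eq_inU (U : Finset (Fin n)) (v : Fin n) : ind U v = (inU U v : ℝ) := by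
  unfold ind inU; split_ifs <;> simp

/-- `Σ_v 1_U(v) = |U|`. -/
theorem sum_ind (U : Finset (Fin n)) : ∑ v, ind U v = U.card := by
  unfold ind
  rw [Finset.sum_ite_mem, Finset.univ_inter, Finset.sum_const, nsmul_eq_mul, mul_one]

/-- `‖1_U‖² = |U|`. -/
theorem sum_ind_sq (U : Finset (Fin n)) : ∑ v, ind U v ^ 2 = U.card := by
  have h : ∀ v, ind U v ^ 2 = ind U v := fun v => by unfold ind; split_ifs <;> simp
  simp_rw [h]; exact sum_ind U

/-- `q_L(1_U) = eL(U)`. -/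
theorem qL_ind (I : LocalMap 4 n m) (U : Finset (Fin n)) : qL I (ind U) = eL I U := by
  unfold qL eL
  rw [Finset.card_filter]
  push_cast
  refine Finset.sum_congr rfl fun j _ => ?_
  unfold tL ind inU
  by_cases h0 : I.vars j 0 ∈ U <;> by_cases h1 : I.vars j 1 ∈ U <;> simp [h0, h1]

/-- `q_A(1_U) = eA(U)`. -/
theorem qA_ind (I : LocalMap 4 n m) (U : Finset (Fin n)) : qA I (ind U) = eA I U := by
  unfold qA eA
  rw [Finset.card_filter]
  push_cast
  refine Finset.sum_congr rfl fun j _ => ?_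
  unfold tA ind inU
  by_cases h2 : I.vars j 2 ∈ U <;> by_cases h3 : I.vars j 3 ∈ U <;> simp [h2, h3]

/-- `q_LA(1_U) = eLA(U)`. -/
theorem qLA_ind (I : LocalMap 4 n m) (U : Finset (Fin n)) : qLA I (ind U) = eLA I U := by
  unfold qLA eLA tL tA
  push_cast
  refine Finset.sum_congr rfl fun j _ => ?_
  simp only [ind_eq_inU]

/-! ## The spectral promise and the reduction to `PseudoRandom` -/

/-- **The spectral (quadratic-form) promise `SpectralPseudoRandom η κ I`** (`C = m/n`): (i) the volume bounds of
`PseudoRandom` (`volL(U) ≤ (1+η)·2C·|U|`, `(1−η)·2C·|U| ≤ volA(U)`, i.e. per-vertex XOR degree `≤ (1+η)2C` and AND degree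
`≥ (1−η)2C`); (ii) for EVERY real vector `x`: `(m/n²)(Σ_v x_v)² − κ√C·Σ_v x_v² ≤ q_L(x)`,
`q_A(x) ≤ (m/n²)(Σ x)² + κ√C·Σ x²`, `q_LA(x) ≤ 4(m/n²)(Σ x)² + 2κ√C·Σ x²` — three positive-semidefiniteness conditions
on explicit symmetric `n × n` matrices (expander mixing in quadratic form: for a `d`-regular multigraph with
`max(|λ₂|, |λ_n|) ≤ λ`, `|½xᵀAx − (d/2n)(Σx)²| ≤ (λ/2)‖x‖²`; here `d_L ≈ d_A ≈ 2C`, `d_LA ≈ 8C`, `λ/2 = κ√C`). -/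
def SpectralPseudoRandom (η κ : ℝ) (I : LocalMap 4 n m) : Prop :=
  (∀ U : Finset (Fin n),
    (volL I U : ℝ) ≤ (1 + η) * (2 * ((m : ℝ) / n)) * U.card ∧
    (1 - η) * (2 * ((m : ℝ) / n)) * U.card ≤ (volA I U : ℝ)) ∧
  ∀ x : Fin n → ℝ,
    (m : ℝ) / n ^ 2 * (∑ v, x v) ^ 2 - κ * Real.sqrt ((m : ℝ) / n) * ∑ v, x v ^ 2 ≤ qL I x ∧
    qA I x ≤ (m : ℝ) / n ^ 2 * (∑ v, x v) ^ 2 + κ * Real.sqrt ((m : ℝ) / n) * ∑ v, x v ^ 2 ∧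
    qLA I x ≤ 4 * ((m : ℝ) / n ^ 2 * (∑ v, x v) ^ 2) + 2 * κ * Real.sqrt ((m : ℝ) / n) * ∑ v, x v ^ 2

/-- **Spectral ⇒ discrepancy**: the quadratic-form promise implies `PseudoRandom η κ` (evaluate at `x = 1_U`). -/
theorem pseudoRandom_of_spectral (η κ : ℝ) (I : LocalMap 4 n m) (h : SpectralPseudoRandom η κ I) :
    PseudoRandom η κ I := by
  intro U
  obtain ⟨hvol, hq⟩ := h
  obtain ⟨hvL, hvA⟩ := hvol U
  obtain ⟨hL, hA, hLA⟩ := hq (ind U)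
  rw [sum_ind, sum_ind_sq] at hL hA hLA
  rw [qL_ind] at hL
  rw [qA_ind] at hA
  rw [qLA_ind] at hLA
  exact ⟨hvL, hvA, hL, hA, hLA⟩

/-- **Isolation from the spectral promise** (`η = 1/50`, `κ = 2`, `m ≥ 900 n`). -/
theorem allOnesIsolated_of_spectral (I : LocalMap 4 n m) (hI : I.IsPure xorAndPred)
    (h : SpectralPseudoRandom (1 / 50) 2 I) (hn : 0 < n) (hm : 900 * n ≤ m) : AllOnesIsolated I :=
  allOnesIsolated_of_pseudoRandom I hI (pseudoRandom_of_spectral _ _ I h) hn hm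

end Summit.PneNP.PneNP.Theorems.PstarIsolationSpectral
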